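import Summits.Ventures.LatticeQCDFlow.Scaling.WeightedHubSchemeFloor
import Summits.Ventures.LatticeQCDFlow.Scaling.ReplicaExchangeBareModeBlocks

/-!
HONEST FRAMING: exact (Metropolis-corrected) sampling algorithms for lattice gauge theory; figures
of merit are autocorrelation/cost numbers at stated couplings and volumes; no continuum-physics
claim.

# HubModeBlocks — THE WEIGHTED HUB EXCHANGE SCHEME `P = t·GSw + (1−t)·prodKernel w M` DECOMPOSED WITH MODE
# ASSIGNMENTS AS BLOCKS: `π̄ = ⊗_k ν_k` (`ν_k(j) = μ_k(A_j)`), RESTRICTION POINCARÉ CONSTANT `(1−t)·min_k w_kγ_A` FROM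
# WITHIN-MODE GAPS ONLY, AND THE PROJECTION CHAIN'S FLOWS: STAR TRANSPOSITIONS `≥ (t/m)·`(assignment-restricted hub-swap
# acceptance), HOT RELABELS `≥ (1−t)w_0·π̄(m)·M̄_0(m_0, j′)` (lean-2 GEN-22, ours)

Venture-side (OURS).  Cell `lqcd-flow` (pub-lqcd), unit `pub-lqcd-lean-2-g22`, 2026-08-26.  Chapter J, file 2: the
hub counterpart of `Scaling/ReplicaExchangeBareModeBlocks` (R2, the adjacent ladder `ptBareSampler`).  The sampler is
the weighted hub exchange scheme of `Scaling/WeightedHubSchemeFloor` (I1): a swap graph `e` of `m` edges with distinct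
endpoints and identity maps containing every hub edge `(0, k+1)`, a Metropolis graph swap `GSw = ptGraphSwap μ e 1`
(`Scaling/ReplicaExchangeGraphSwap`) with probability `t`, else ONE replica updated, replica `k` with probability `w_k`,
by its own `μ_k`-reversible kernel `M_k` (`prodKernel w M`).  Blocks: the MODE ASSIGNMENT `mode ∘ x : Fin (K+1) → J`
of a partition `mode : S → J` of the configuration space (topological sectors).  The vocabulary is the Literature's
decomposition theorem (`MarkovChainDecomposition`): block masses, restriction chains, the projection chain `P̄` and its
flows — here exactly the two edge families of `Scaling/StarConveyorRotation` (J1): star transpositions (accepted hub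
swaps) and relabelling at the hot position `0` (sector-crossing hot updates).

## What is proved

* §1 `whub_ge_update` (`P ≥ (1−t)·prodKernel w M` entrywise); **`hubMode_restriction_poincare`** — every restriction
  chain satisfies `((1−t)c)·Var ≤ 𝓔` as soon as `c ≤ w_kγ_A` for all `k` and each `M_k` restricted to each mode has
  Poincaré constant `γ_A` (swaps only add; tensorisation `Scaling/ProductChainModeRestriction`).
* §2 **`hubMode_blockFlow_swap_ge`** — for a hub edge `(0, k+1)` and `m∘τ_k ≠ m`:
  `π̄(m)P̄(m, m∘τ_k) ≥ (t/m)·Σ_{x : mode∘x = m} min{π̃(x), π̃(x∘τ_k)}`; **`hubMode_blockFlow_relabel_ge`** — for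
  `j′ ≠ m_0`: `π̄(m)P̄(m, m^{0←j′}) ≥ (1−t)w_0·π̄(m)·M̄_0(m_0, j′)`, `M̄_0 = projectionChain μ_0 M_0 mode`.
* §3 the same two bounds as the hypotheses `hT`, `hR` of `starConveyor_poincare` for `(π̄, P̄)`
  (**`hubMode_proj_swap`**, **`hubMode_proj_relabel`**) under the assignment-restricted HUB-swap overlap
  `δ₂·min{π̄(m), π̄(m∘τ_k)} ≤ Σ_{x : mode∘x = m} min{π̃(x), π̃(x∘τ_k)}`.

NOT CLAIMED: the gap (file J3 `Scaling/HubModeGap`); the reduction of the assignment-restricted overlap to the direct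
hot–cold sector-wise overlaps; transport maps on the hub edges (J4, by conjugacy).  Literature grade (cell rule):
KNOWN MECHANISM (decomposition of swapping chains by mode labels: Madras–Zheng 2003, Woodard–Schmidler–Huber 2009),
NEW TYPING (hub topology, update weights); nothing cited as a fact; no new bib keys.
-/

noncomputable section

open Finset Function
open Literature.Probability.MarkovChains
open Literature.Probability.MarkovChains.Decomposition

namespace Summit.Ventures.LatticeQCDFlow.Scaling

variable {S J : Type*} [Fintype S] [DecidableEq S] [DecidableEq J] {K m : ℕ}
  {μ : Fin (K + 1) → S → ℝ} {M : Fin (K + 1) → S → S → ℝ} {w : Fin (K + 1) → ℝ} {mode : S → J} {t : ℝ}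
  {e : Fin m → Fin (K + 1) × Fin (K + 1)}

/-! ## §1 The restriction chains: within-mode gaps only -/

omit [DecidableEq J] in
/-- **The hub scheme dominates its update part:** `P(x,y) ≥ (1−t)·prodKernel w M (x,y)` (`0 ≤ t`, `μ_k > 0`). [ours] -/
theorem whub_ge_update (hμ : ∀ k x, 0 < μ k x) (ht0 : 0 ≤ t) (x y : Fin (K + 1) → S) :
    (1 - t) * prodKernel w M x y
      ≤ t * ptGraphSwap μ e (fun _ : Fin m => Equiv.refl S) x y + (1 - t) * prodKernel w M x y :=
  le_add_of_nonneg_left (mul_nonneg ht0 ((ptGraphSwap_isRowStochastic hμ).1 x y))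

/-- **The restriction chain of an assignment contains the restricted product update, slowed by `1 − t`:** its
Dirichlet form dominates `(1 − t)·` that of the restriction of `prodKernel w M` (swaps only add). [ours] -/
theorem hubMode_dirichletForm_restriction_ge (hμ : ∀ k x, 0 < μ k x) (ht0 : 0 ≤ t)
    (i : Fin (K + 1) → J) (f : (Fin (K + 1) → S) → ℝ) :
    (1 - t) * dirichletForm (blockLaw (tensorFun μ) (fun z : Fin (K + 1) → S => mode ∘ z) i)
        (restrictionChain (prodKernel w M) (fun z : Fin (K + 1) → S => mode ∘ z)) f
      ≤ dirichletForm (blockLaw (tensorFun μ) (fun z : Fin (K + 1) → S => mode ∘ z) i)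
          (restrictionChain (fun x y : Fin (K + 1) → S =>
              t * ptGraphSwap μ e (fun _ : Fin m => Equiv.refl S) x y + (1 - t) * prodKernel w M x y)
            (fun z : Fin (K + 1) → S => mode ∘ z)) f := by
  unfold dirichletForm
  rw [← mul_assoc, mul_comm (1 - t), mul_assoc, mul_sum]
  refine mul_le_mul_of_nonneg_left (sum_le_sum fun x _ => ?_) (by norm_num)
  rw [mul_sum]
  refine sum_le_sum fun y _ => ?_
  have hL : 0 ≤ blockLaw (tensorFun μ) (fun z : Fin (K + 1) → S => mode ∘ z) i x :=
    blockLaw_nonneg (fun z => (tensorFun_pos hμ z).le) _ i x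
  rw [mul_assoc, mul_assoc, restrictionChain_mul_sq_sub, restrictionChain_mul_sq_sub, ← mul_assoc, ← mul_assoc,
    mul_comm (1 - t), mul_assoc, mul_assoc]
  refine mul_le_mul_of_nonneg_left ?_ hL
  split_ifs with hb
  · rw [← mul_assoc]
    exact mul_le_mul_of_nonneg_right (whub_ge_update (e := e) (w := w) (M := M) hμ ht0 x y) (sq_nonneg _)
  · simp

/-- **THE RESTRICTION POINCARÉ CONSTANT `(1 − t)·min_k w_kγ_A`:** if every within-level update restricted to every
mode satisfies `γ_A·Var ≤ 𝓔`, `w ≥ 0` and `c ≤ w_kγ_A` for all `k`, then for every assignment `i` and every `f`,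
`((1 − t)c)·Var_{π̃(·|i)}(f) ≤ 𝓔_{π̃(·|i)}(P_i; f)` (`0 ≤ t ≤ 1`). [ours] -/
theorem hubMode_restriction_poincare (hμ : ∀ k x, 0 < μ k x) (hmode : Function.Surjective mode)
    (hM : ∀ k, IsRowStochastic (M k)) (hw0 : ∀ k, 0 ≤ w k) (ht0 : 0 ≤ t) (ht1 : t ≤ 1) {γA c : ℝ}
    (hc : ∀ k, c ≤ w k * γA)
    (hgapA : ∀ k j, ∀ h : S → ℝ, γA * lawVariance (blockLaw (μ k) mode j) h
      ≤ dirichletForm (blockLaw (μ k) mode j) (restrictionChain (M k) mode) h)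
    (i : Fin (K + 1) → J) (f : (Fin (K + 1) → S) → ℝ) :
    (1 - t) * c * lawVariance (blockLaw (tensorFun μ) (fun z : Fin (K + 1) → S => mode ∘ z) i) f
      ≤ dirichletForm (blockLaw (tensorFun μ) (fun z : Fin (K + 1) → S => mode ∘ z) i)
          (restrictionChain (fun x y : Fin (K + 1) → S =>
              t * ptGraphSwap μ e (fun _ : Fin m => Equiv.refl S) x y + (1 - t) * prodKernel w M x y)
            (fun z : Fin (K + 1) → S => mode ∘ z)) f := by
  have h1 := prodKernel_restriction_poincare (M := M) (w := w) hμ hmode hM hw0 hc hgapA i f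
  have h2 := hubMode_dirichletForm_restriction_ge (e := e) (w := w) (M := M) (mode := mode) hμ ht0 i f
  calc (1 - t) * c * lawVariance (blockLaw (tensorFun μ) (fun z : Fin (K + 1) → S => mode ∘ z) i) f
      = (1 - t) * (c * lawVariance (blockLaw (tensorFun μ) (fun z : Fin (K + 1) → S => mode ∘ z) i) f) := by ring
    _ ≤ (1 - t) * dirichletForm (blockLaw (tensorFun μ) (fun z : Fin (K + 1) → S => mode ∘ z) i)
          (restrictionChain (prodKernel w M) (fun z : Fin (K + 1) → S => mode ∘ z)) f :=
        mul_le_mul_of_nonneg_left h1 (by linarith)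
    _ ≤ _ := h2

/-! ## §2 The projection chain's flows -/

omit [Fintype S] [DecidableEq S] [DecidableEq J] in
/-- A star swap carries an assignment block to the swapped assignment block. [ours] -/
theorem modes_comp_starSwap (x : Fin (K + 1) → S) (k : Fin K) :
    mode ∘ (x ∘ Equiv.swap (0 : Fin (K + 1)) k.succ) = (mode ∘ x) ∘ Equiv.swap (0 : Fin (K + 1)) k.succ := rfl

/-- The hub scheme is non-negative. [ours] -/
theorem whub_nonneg (hμ : ∀ k x, 0 < μ k x) (hM : ∀ k, IsRowStochastic (M k)) (hw0 : ∀ k, 0 ≤ w k)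
    (hw1 : ∑ k, w k = 1) (ht0 : 0 ≤ t) (ht1 : t ≤ 1) (x y : Fin (K + 1) → S) :
    0 ≤ t * ptGraphSwap μ e (fun _ : Fin m => Equiv.refl S) x y + (1 - t) * prodKernel w M x y :=
  (weightedScheme_isRowStochastic (ptGraphSwap_isRowStochastic hμ) hM hw0 hw1 ht0 ht1).1 x y

/-- **Star-transposition flows:** for a hub edge `e_j = (0, k+1)` and an assignment with `m∘τ_k ≠ m`,
`π̄(m)P̄(m, m∘τ_k) ≥ (t/m)·Σ_{x : mode∘x = m} min{π̃(x), π̃(x∘τ_k)}` (`0 ≤ t ≤ 1`). [ours] -/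
theorem hubMode_blockFlow_swap_ge (he : ∀ r, (e r).1 ≠ (e r).2) (hμ : ∀ k x, 0 < μ k x)
    (hM : ∀ k, IsRowStochastic (M k)) (hw0 : ∀ k, 0 ≤ w k) (hw1 : ∑ k, w k = 1) (ht0 : 0 ≤ t) (ht1 : t ≤ 1)
    (i : Fin (K + 1) → J) {k : Fin K} {j : Fin m} (hj : e j = ((0 : Fin (K + 1)), k.succ))
    (hik : i ∘ Equiv.swap (0 : Fin (K + 1)) k.succ ≠ i) :
    t / m * ∑ x ∈ block (fun z : Fin (K + 1) → S => mode ∘ z) i,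
        min (tensorFun μ x) (tensorFun μ (x ∘ Equiv.swap (0 : Fin (K + 1)) k.succ))
      ≤ blockFlow (tensorFun μ) (fun x y : Fin (K + 1) → S =>
            t * ptGraphSwap μ e (fun _ : Fin m => Equiv.refl S) x y + (1 - t) * prodKernel w M x y)
          (fun z : Fin (K + 1) → S => mode ∘ z) i (i ∘ Equiv.swap (0 : Fin (K + 1)) k.succ) := by
  unfold blockFlow
  rw [mul_sum]
  refine sum_le_sum fun x hx => ?_
  have hxm : mode ∘ x = i := mem_block.mp hx
  have hy : x ∘ Equiv.swap (0 : Fin (K + 1)) k.succ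
      ∈ block (fun z : Fin (K + 1) → S => mode ∘ z) (i ∘ Equiv.swap (0 : Fin (K + 1)) k.succ) := by
    rw [mem_block, modes_comp_starSwap, hxm]
  have hxfix : x ∘ Equiv.swap (0 : Fin (K + 1)) k.succ ≠ x := by
    intro hfix
    apply hik
    rw [← hxm, ← modes_comp_starSwap, hfix]
  calc t / m * min (tensorFun μ x) (tensorFun μ (x ∘ Equiv.swap (0 : Fin (K + 1)) k.succ))
      ≤ tensorFun μ x * (t * ptGraphSwap μ e (fun _ : Fin m => Equiv.refl S) x (x ∘ Equiv.swap (0 : Fin (K + 1)) k.succ)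
          + (1 - t) * prodKernel w M x (x ∘ Equiv.swap (0 : Fin (K + 1)) k.succ)) :=
        whub_swap_flow_ge e he hμ hM hw0 hw1 ht0 ht1 x hj hxfix
    _ ≤ ∑ y ∈ block (fun z : Fin (K + 1) → S => mode ∘ z) (i ∘ Equiv.swap (0 : Fin (K + 1)) k.succ),
          tensorFun μ x * (t * ptGraphSwap μ e (fun _ : Fin m => Equiv.refl S) x y + (1 - t) * prodKernel w M x y) :=
        single_le_sum (f := fun y => tensorFun μ x
            * (t * ptGraphSwap μ e (fun _ : Fin m => Equiv.refl S) x y + (1 - t) * prodKernel w M x y))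
          (fun y _ => mul_nonneg (tensorFun_pos hμ x).le (whub_nonneg hμ hM hw0 hw1 ht0 ht1 x y)) hy

/-- **Hot-relabel flows:** for `j′ ≠ m_0`, `π̄(m)P̄(m, m^{0←j′}) ≥ (1−t)w_0·π̄(m)·M̄_0(m_0, j′)`,
`M̄_0 = projectionChain μ_0 M_0 mode` the mode projection of the hot update, `π̄ = tensorFun ν`, `ν_k(j) = μ_k(A_j)`
(`0 ≤ t ≤ 1`, `w ≥ 0`, `Σw = 1`). [ours] -/
theorem hubMode_blockFlow_relabel_ge (hμ : ∀ k x, 0 < μ k x) (hmode : Function.Surjective mode)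
    (hM : ∀ k, IsRowStochastic (M k)) (hw0 : ∀ k, 0 ≤ w k) (hw1 : ∑ k, w k = 1) (ht0 : 0 ≤ t) (ht1 : t ≤ 1)
    (i : Fin (K + 1) → J) {j' : J} (hj : j' ≠ i 0) :
    (1 - t) * w 0 * (tensorFun (fun k => blockMass (μ k) mode) i * projectionChain (μ 0) (M 0) mode (i 0) j')
      ≤ blockFlow (tensorFun μ) (fun x y : Fin (K + 1) → S =>
            t * ptGraphSwap μ e (fun _ : Fin m => Equiv.refl S) x y + (1 - t) * prodKernel w M x y)
          (fun z : Fin (K + 1) → S => mode ∘ z) i (update i 0 j') := by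
  set P : Matrix (Fin (K + 1) → S) (Fin (K + 1) → S) ℝ := fun x y =>
    t * ptGraphSwap μ e (fun _ : Fin m => Equiv.refl S) x y + (1 - t) * prodKernel w M x y with hP
  set ν : Fin (K + 1) → J → ℝ := fun k => blockMass (μ k) mode with hν
  set g : S → ℝ := fun a => ∑ b ∈ block mode j', M 0 a b with hg
  have hGS0 : ∀ x y, 0 ≤ ptGraphSwap μ e (fun _ : Fin m => Equiv.refl S) x y := (ptGraphSwap_isRowStochastic hμ).1
  have hP0 : ∀ x y, 0 ≤ P x y := whub_nonneg hμ hM hw0 hw1 ht0 ht1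
  -- Step 1: keep only the one-coordinate hot moves into `A_{j'}`
  have S1 : (1 - t) * w 0 * ∑ x ∈ block (fun z : Fin (K + 1) → S => mode ∘ z) i, tensorFun μ x * g (x 0)
      ≤ blockFlow (tensorFun μ) P (fun z : Fin (K + 1) → S => mode ∘ z) i (update i 0 j') := by
    unfold blockFlow
    rw [mul_sum]
    refine sum_le_sum fun x hx => ?_
    have hxm : mode ∘ x = i := mem_block.mp hx
    have hinj : Set.InjOn (fun b : S => update x 0 b) ↑(block mode j') := fun b _ b' _ h => update_injective x 0 h
    have himg : (block mode j').image (fun b : S => update x 0 b)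
        ⊆ block (fun z : Fin (K + 1) → S => mode ∘ z) (update i 0 j') := by
      intro y hy
      rw [mem_image] at hy
      obtain ⟨b, hb, rfl⟩ := hy
      rw [mem_block]
      change mode ∘ update x 0 b = update i 0 j'
      rw [comp_update, hxm, mem_block.mp hb]
    calc (1 - t) * w 0 * (tensorFun μ x * g (x 0))
        = ∑ b ∈ block mode j', (1 - t) * w 0 * (tensorFun μ x * M 0 (x 0) b) := by
          rw [hg, mul_sum, mul_sum]
      _ ≤ ∑ b ∈ block mode j', tensorFun μ x * P x (update x 0 b) := by
          refine sum_le_sum fun b hb => whub_hot_flow_ge (M := M) (w := w) hGS0 hμ ht0 x ?_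
          intro h'
          apply hj
          have h1 : mode b = j' := mem_block.mp hb
          have h2 : mode (x 0) = i 0 := congrFun hxm 0
          rw [← h1, h', h2]
      _ = ∑ y ∈ (block mode j').image (fun b : S => update x 0 b), tensorFun μ x * P x y :=
          (sum_image (f := fun y => tensorFun μ x * P x y) hinj).symm
      _ ≤ ∑ y ∈ block (fun z : Fin (K + 1) → S => mode ∘ z) (update i 0 j'), tensorFun μ x * P x y :=
          sum_le_sum_of_subset_of_nonneg himg fun y _ _ => mul_nonneg (tensorFun_pos hμ x).le (hP0 x y)
  -- Step 2: the block-restricted one-coordinate marginal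
  have S2 : ∑ x ∈ block (fun z : Fin (K + 1) → S => mode ∘ z) i, tensorFun μ x * g (x 0)
      = (∑ a ∈ block mode (i 0), μ 0 a * g a) * ∏ k ∈ univ \ {0}, ν k (i k) := by
    have e1 : ∑ x ∈ block (fun z : Fin (K + 1) → S => mode ∘ z) i, tensorFun μ x * g (x 0)
        = ∑ x : Fin (K + 1) → S, tensorFun (fun k u => if mode u = i k then μ k u else 0) x * g (x 0) := by
      unfold block
      rw [sum_filter]
      refine sum_congr rfl fun x _ => ?_
      rw [← tensorFun_modeIndicator i x]
      split_ifs <;> simp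
    rw [e1, sum_tensorFun_mul_apply_of_unnormalised]
    congr 1
    · unfold block
      rw [sum_filter]
      refine sum_congr rfl fun a _ => ?_
      split_ifs <;> simp
    · refine prod_congr rfl fun k _ => ?_
      simp only [hν]
      unfold blockMass block
      rw [sum_filter]
  -- Step 3: identify the hot factor with the mode projection of `M_0`
  have hν0 : ν 0 (i 0) ≠ 0 := (blockMass_pos (hμ 0) hmode (i 0)).ne'
  have S3 : ∑ a ∈ block mode (i 0), μ 0 a * g a = ν 0 (i 0) * projectionChain (μ 0) (M 0) mode (i 0) j' := by
    rw [blockMass_mul_projectionChain hν0]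
    unfold blockFlow
    simp only [hg, mul_sum]
  have S4 : tensorFun ν i = ν 0 (i 0) * ∏ k ∈ univ \ {0}, ν k (i k) := tensorFun_eq_mul_prod ν i 0
  calc (1 - t) * w 0 * (tensorFun ν i * projectionChain (μ 0) (M 0) mode (i 0) j')
      = (1 - t) * w 0 * ((ν 0 (i 0) * projectionChain (μ 0) (M 0) mode (i 0) j')
          * ∏ k ∈ univ \ {0}, ν k (i k)) := by rw [S4]; ring
    _ = (1 - t) * w 0 * ∑ x ∈ block (fun z : Fin (K + 1) → S => mode ∘ z) i, tensorFun μ x * g (x 0) := by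
        rw [S2, S3]
    _ ≤ _ := S1

/-! ## §3 The star-conveyor hypotheses for `(π̄, P̄)` -/

/-- **Hypothesis `hT` of `starConveyor_poincare` for the projection chain:** under the assignment-restricted hub-swap
overlap `δ₂·min{π̄(m), π̄(m∘τ_k)} ≤ Σ_{x : mode∘x = m} min{π̃(x), π̃(x∘τ_k)}` and with the hub edges in the graph,
`(tδ₂/m)·min{π̄(m), π̄(m∘τ_k)} ≤ π̄(m)·P̄(m, m∘τ_k)` whenever `m∘τ_k ≠ m`. [ours] -/
theorem hubMode_proj_swap (he : ∀ r, (e r).1 ≠ (e r).2) (hhub : ∀ k : Fin K, ∃ j, e j = ((0 : Fin (K + 1)), k.succ))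
    (hμ : ∀ k x, 0 < μ k x) (hmode : Function.Surjective mode) (hM : ∀ k, IsRowStochastic (M k))
    (hw0 : ∀ k, 0 ≤ w k) (hw1 : ∑ k, w k = 1) (ht0 : 0 ≤ t) (ht1 : t ≤ 1) {δ₂ : ℝ}
    (hδ : ∀ (i : Fin (K + 1) → J) (k : Fin K), i ∘ Equiv.swap (0 : Fin (K + 1)) k.succ ≠ i →
      δ₂ * min (blockMass (tensorFun μ) (fun z : Fin (K + 1) → S => mode ∘ z) i)
          (blockMass (tensorFun μ) (fun z : Fin (K + 1) → S => mode ∘ z) (i ∘ Equiv.swap (0 : Fin (K + 1)) k.succ))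
        ≤ ∑ x ∈ block (fun z : Fin (K + 1) → S => mode ∘ z) i,
            min (tensorFun μ x) (tensorFun μ (x ∘ Equiv.swap (0 : Fin (K + 1)) k.succ)))
    (i : Fin (K + 1) → J) (k : Fin K) (hik : i ∘ Equiv.swap (0 : Fin (K + 1)) k.succ ≠ i) :
    t * δ₂ / m * min (tensorFun (fun k => blockMass (μ k) mode) i)
        (tensorFun (fun k => blockMass (μ k) mode) (i ∘ Equiv.swap (0 : Fin (K + 1)) k.succ))
      ≤ tensorFun (fun k => blockMass (μ k) mode) i
          * projectionChain (tensorFun μ) (fun x y : Fin (K + 1) → S =>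
                t * ptGraphSwap μ e (fun _ : Fin m => Equiv.refl S) x y + (1 - t) * prodKernel w M x y)
              (fun z : Fin (K + 1) → S => mode ∘ z) i (i ∘ Equiv.swap (0 : Fin (K + 1)) k.succ) := by
  obtain ⟨j, hj⟩ := hhub k
  rw [← ptBareMode_blockMass i, ← ptBareMode_blockMass (i ∘ Equiv.swap (0 : Fin (K + 1)) k.succ),
    blockMass_mul_projectionChain (ptBareMode_blockMass_pos hμ hmode i).ne']
  calc t * δ₂ / m * min (blockMass (tensorFun μ) (fun z : Fin (K + 1) → S => mode ∘ z) i)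
        (blockMass (tensorFun μ) (fun z : Fin (K + 1) → S => mode ∘ z) (i ∘ Equiv.swap (0 : Fin (K + 1)) k.succ))
      = t / m * (δ₂ * min (blockMass (tensorFun μ) (fun z : Fin (K + 1) → S => mode ∘ z) i)
          (blockMass (tensorFun μ) (fun z : Fin (K + 1) → S => mode ∘ z) (i ∘ Equiv.swap (0 : Fin (K + 1)) k.succ))) := by
        ring
    _ ≤ t / m * ∑ x ∈ block (fun z : Fin (K + 1) → S => mode ∘ z) i,
          min (tensorFun μ x) (tensorFun μ (x ∘ Equiv.swap (0 : Fin (K + 1)) k.succ)) :=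
        mul_le_mul_of_nonneg_left (hδ i k hik) (by positivity)
    _ ≤ _ := hubMode_blockFlow_swap_ge he hμ hM hw0 hw1 ht0 ht1 i hj hik

/-- **Hypothesis `hR` of `starConveyor_poincare` for the projection chain:** for `j′ ≠ m_0`,
`(1−t)w_0·(π̄(m)·M̄_0(m_0, j′)) ≤ π̄(m)·P̄(m, m^{0←j′})` with `π̄ = tensorFun ν`. [ours] -/
theorem hubMode_proj_relabel (hμ : ∀ k x, 0 < μ k x) (hmode : Function.Surjective mode)
    (hM : ∀ k, IsRowStochastic (M k)) (hw0 : ∀ k, 0 ≤ w k) (hw1 : ∑ k, w k = 1) (ht0 : 0 ≤ t) (ht1 : t ≤ 1)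
    (i : Fin (K + 1) → J) (j' : J) (hj : j' ≠ i 0) :
    (1 - t) * w 0 * (tensorFun (fun k => blockMass (μ k) mode) i * projectionChain (μ 0) (M 0) mode (i 0) j')
      ≤ tensorFun (fun k => blockMass (μ k) mode) i
          * projectionChain (tensorFun μ) (fun x y : Fin (K + 1) → S =>
                t * ptGraphSwap μ e (fun _ : Fin m => Equiv.refl S) x y + (1 - t) * prodKernel w M x y)
              (fun z : Fin (K + 1) → S => mode ∘ z) i (update i 0 j') := by
  rw [← ptBareMode_blockMass i, blockMass_mul_projectionChain (ptBareMode_blockMass_pos hμ hmode i).ne',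
    ptBareMode_blockMass i]
  exact hubMode_blockFlow_relabel_ge hμ hmode hM hw0 hw1 ht0 ht1 i hj

end Summit.Ventures.LatticeQCDFlow.Scaling

end
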